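import Summits.RiemannHypothesis.RiemannHypothesis.Theorems.SoloInformedGroundStateDefectBounds

/-!
# The single-pair visibility inequality for the Weil ground state

(solo RiemannHypothesis/informed, session 4 — the exact half of the "visibility threshold" of an
off-line zero; memo `paper/sharpest.md` §2e (D6).)

From the defect identity `Re Q_T(g) = Z_T(g) − D_T(g)/2`
(`re_weilZeroSidePartial_weilQuadratic_eq`) and `D_T ≥ 0` termwise, ONE reflected pair
`{ρ₀, ρ₀* := 1 − ρ̄₀}` already gives

`Re Q_T(g) ≤ Z_T(g) − m(ρ₀)·|ĝ(ρ₀) − ĝ(ρ₀*)|²`            (`…_le_zeroSum_sub_pair`),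

hence, by the explicit formula and the variational definition of the ground energy,

`ε(a) ≤ (B − m(ρ₀)|ĝ(ρ₀) − ĝ(ρ₀*)|²) / ‖g‖₂²`  whenever `sup_T Z_T(g) ≤ B`, `supp g ⊆ [−a,a]`
(`weilGroundEnergy_le_of_pair`).

For the twisted odd dipole `g(t) = h(t)e^{−iγ₀t}` (`h` odd) aimed at a zero `ρ₀ = ½ + η + iγ₀`
one has `ĝ(ρ₀) − ĝ(ρ₀*) = 2∫ h(t)e^{ηt} dt` (`weilMellin_twist_sub_reflect`), so

`ε(a) ≤ (B − 4·m(ρ₀)·|∫ h e^{ηt}|²) / ‖h‖₂²`              (`weilGroundEnergy_le_of_oddDipole`):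

the zero is VISIBLE in the ground state at window `a` (`ε(a) < 0`) as soon as the zero-sampling
energy `B` of the dipole is below the dipole gain `4m(ρ₀)|∫ h e^{ηt}|²`; since the pair itself
contributes `2m(ρ₀)|∫ h e^{ηt}|²` to `Z_T`, this says: the pair outweighs all other zeros.  With
`h ≈ sinh(ηt)` on `[−a,a]` the gain per unit norm is `≈ 4(sinh(2ηa)/(2η) − a) ~ e^{2ηa}/η`, while
the on-line background is heuristically `≈ log(γ₀/2π)` — the doubly-logarithmic visibility
threshold `a₀(η,γ₀) ≈ (2η)⁻¹ log(2η log γ₀)` of the memo.  Only the inequality is claimed here; the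
size of `B` is not estimated in this file.
-/

open Complex Filter Set Topology Metric MeasureTheory
open Literature.NumberTheory.LFunctions Literature.NumberTheory.LFunctions.WeilContinuous
open scoped ComplexConjugate

namespace Summit.RiemannHypothesis.RiemannHypothesis.Theorems

section Dipole

variable {g : ℝ → ℂ}

/-- One reflected pair bounds the defect from below: `2·m(ρ₀)|ĝ(ρ₀) − ĝ(ρ₀*)|² ≤ D_T(g)`
(both members of the pair carry the same term; if `ρ₀* = ρ₀` the term vanishes). -/
theorem two_mul_pairDefect_le_defectSum (g : ℝ → ℂ) {T : ℝ} {ρ₀ : ℂ}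
    (h₀ : ρ₀ ∈ weilZeroIndex T) :
    2 * ((riemannZetaZeroOrder ρ₀ : ℝ) * ‖weilMellin g ρ₀ - weilMellin g (1 - conj ρ₀)‖ ^ 2) ≤
      ∑ᶠ ρ ∈ weilZeroIndex T,
        (riemannZetaZeroOrder ρ : ℝ) * ‖weilMellin g ρ - weilMellin g (1 - conj ρ)‖ ^ 2 := by
  have hfin := weilZeroIndex_finite T
  have hmem : ∀ ρ, ρ ∈ hfin.toFinset ↔ ρ ∈ weilZeroIndex T := fun ρ ↦ hfin.mem_toFinset
  rw [finsum_mem_eq_finite_toFinset_sum _ hfin]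
  set F := hfin.toFinset with hF
  have hnonneg : ∀ ρ ∈ F,
      0 ≤ (riemannZetaZeroOrder ρ : ℝ) * ‖weilMellin g ρ - weilMellin g (1 - conj ρ)‖ ^ 2 :=
    fun ρ hρ ↦ mul_nonneg (riemannZetaZeroOrder_nonneg_of_mem_weilZeroIndex ((hmem ρ).1 hρ))
      (sq_nonneg _)
  have h₀' : 1 - conj ρ₀ ∈ weilZeroIndex T := one_sub_conj_mem_weilZeroIndex h₀
  by_cases heq : 1 - conj ρ₀ = ρ₀
  · have hz : weilMellin g ρ₀ - weilMellin g (1 - conj ρ₀) = 0 := by rw [heq, sub_self]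
    rw [hz, norm_zero]
    simpa using Finset.sum_nonneg hnonneg
  · have hsub : ({ρ₀, 1 - conj ρ₀} : Finset ℂ) ⊆ F := by
      intro ρ hρ
      simp only [Finset.mem_insert, Finset.mem_singleton] at hρ
      rcases hρ with rfl | rfl
      · exact (hmem _).2 h₀
      · exact (hmem _).2 h₀'
    have hpair := Finset.sum_le_sum_of_subset_of_nonneg hsub fun ρ hρ _ ↦ hnonneg ρ hρ
    rw [Finset.sum_pair (Ne.symm heq)] at hpair
    obtain ⟨hre0, hre1⟩ := re_pos_and_lt_one_of_mem_weilZeroIndex h₀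
    have hord : riemannZetaZeroOrder (1 - conj ρ₀) = riemannZetaZeroOrder ρ₀ :=
      riemannZetaZeroOrder_one_sub_conj hre0 hre1
    have hinv : 1 - conj (1 - conj ρ₀) = ρ₀ := by simp
    rw [hord, hinv, norm_sub_rev (weilMellin g (1 - conj ρ₀))] at hpair
    linarith

/-- **Single-pair visibility inequality, truncated form**:
`Re Σ_{|Im ρ| ≤ T} m(ρ)(g ⋆ g̃)^(ρ) ≤ Z_T(g) − m(ρ₀)|ĝ(ρ₀) − ĝ(1 − ρ̄₀)|²` for every indexed zero `ρ₀`. -/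
theorem re_weilZeroSidePartial_weilQuadratic_le_zeroSum_sub_pair (hg : IsWeilTest g) {T : ℝ}
    {ρ₀ : ℂ} (h₀ : ρ₀ ∈ weilZeroIndex T) :
    (weilZeroSidePartial (weilConv g (weilReflect g)) T).re ≤
      (∑ᶠ ρ ∈ weilZeroIndex T, (riemannZetaZeroOrder ρ : ℝ) * ‖weilMellin g ρ‖ ^ 2) -
        (riemannZetaZeroOrder ρ₀ : ℝ) * ‖weilMellin g ρ₀ - weilMellin g (1 - conj ρ₀)‖ ^ 2 := by
  rw [re_weilZeroSidePartial_weilQuadratic_eq hg T]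
  have := two_mul_pairDefect_le_defectSum g h₀
  linarith

/-- **Single-pair visibility inequality for `Q`** (explicit formula + the truncated form at every
height `T ≥ |Im ρ₀|`): if `sup_T Z_T(g) ≤ B` then `Re Q(g) ≤ B − m(ρ₀)|ĝ(ρ₀) − ĝ(1 − ρ̄₀)|²`
for every zero `ρ₀` of `ζ` with `0 ≤ Re ρ₀ ≤ 1`, `Im ρ₀ ≠ 0`. -/
theorem re_weilQuadratic_le_of_zeroSum_le_sub_pair (hg : IsWeilTest g) {ρ₀ : ℂ}
    (hζ : riemannZeta ρ₀ = 0) (h0 : 0 ≤ ρ₀.re) (h1 : ρ₀.re ≤ 1) (him : ρ₀.im ≠ 0) {B : ℝ}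
    (hB : ∀ T : ℝ,
      ∑ᶠ ρ ∈ weilZeroIndex T, (riemannZetaZeroOrder ρ : ℝ) * ‖weilMellin g ρ‖ ^ 2 ≤ B) :
    (weilQuadratic g).re ≤
      B - (riemannZetaZeroOrder ρ₀ : ℝ) * ‖weilMellin g ρ₀ - weilMellin g (1 - conj ρ₀)‖ ^ 2 := by
  have hk : IsWeilTest (weilConv g (weilReflect g)) := hg.weilConv hg.weilReflect
  have hlim : Tendsto (fun T ↦ (weilZeroSidePartial (weilConv g (weilReflect g)) T).re) atTop
      (𝓝 (weilQuadratic g).re) :=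
    (Complex.continuous_re.tendsto _).comp (explicit_formula_holds hk)
  refine le_of_tendsto hlim ?_
  filter_upwards [eventually_ge_atTop |ρ₀.im|] with T hT
  have hmemT : ρ₀ ∈ weilZeroIndex T := ⟨hζ, h0, h1, him, hT⟩
  exact (re_weilZeroSidePartial_weilQuadratic_le_zeroSum_sub_pair hg hmemT).trans
    (by linarith [hB T])

/-- **Single-pair visibility inequality for the ground energy**:
`ε(a) ≤ (B − m(ρ₀)|ĝ(ρ₀) − ĝ(1 − ρ̄₀)|²) / ‖g‖₂²` for every test `g` on `[−a, a]` with
`sup_T Z_T(g) ≤ B`. In particular the off-line zero `ρ₀` is visible (`ε(a) < 0`) as soon as some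
window test has zero-sampling energy below its pair defect at `ρ₀`. -/
theorem weilGroundEnergy_le_of_pair (hg : IsWeilTest g) {a : ℝ} (hgs : tsupport g ⊆ Icc (-a) a)
    (hpos : 0 < ∫ t, ‖g t‖ ^ 2) {ρ₀ : ℂ} (hζ : riemannZeta ρ₀ = 0) (h0 : 0 ≤ ρ₀.re)
    (h1 : ρ₀.re ≤ 1) (him : ρ₀.im ≠ 0) {B : ℝ}
    (hB : ∀ T : ℝ,
      ∑ᶠ ρ ∈ weilZeroIndex T, (riemannZetaZeroOrder ρ : ℝ) * ‖weilMellin g ρ‖ ^ 2 ≤ B) :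
    weilGroundEnergy a ≤
      (B - (riemannZetaZeroOrder ρ₀ : ℝ) * ‖weilMellin g ρ₀ - weilMellin g (1 - conj ρ₀)‖ ^ 2) /
        ∫ t, ‖g t‖ ^ 2 :=
  (weilGroundEnergy_le_div hg hgs hpos).trans
    (div_le_div_of_nonneg_right
      (re_weilQuadratic_le_of_zeroSum_le_sub_pair hg hζ h0 h1 him hB) hpos.le)

/-! ### The twisted odd dipole -/

/-- Frequency/tilt shift of the transform: `(g(t)e^{ct})^(s) = ĝ(s + c)` for complex `c`. -/
theorem weilMellin_mul_cexp (g : ℝ → ℂ) (c s : ℂ) :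
    weilMellin (fun t ↦ g t * cexp (c * t)) s = weilMellin g (s + c) := by
  unfold weilMellin
  congr 1 with t
  rw [mul_assoc, ← Complex.exp_add]
  congr 2
  ring

/-- Twisted tests are tests. -/
theorem isWeilTest_mul_cexp (hg : IsWeilTest g) (c : ℂ) :
    IsWeilTest fun t ↦ g t * cexp (c * t) := by
  refine ⟨hg.1.mul ?_, hg.2.mul_right⟩
  have h1 : ContDiff ℝ (⊤ : ℕ∞) fun t : ℝ ↦ c * (t : ℂ) :=
    contDiff_const.mul Complex.ofRealCLM.contDiff
  exact Complex.contDiff_exp.comp h1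

/-- A unimodular twist does not change `|g|`. -/
theorem norm_mul_cexp_neg_mul_I (g : ℝ → ℂ) (γ₀ t : ℝ) :
    ‖g t * cexp (-(γ₀ * I) * t)‖ = ‖g t‖ := by
  rw [norm_mul, Complex.norm_exp]
  simp

/-- For an odd `h`: `∫ h(t)e^{−ηt} dt = −∫ h(t)e^{ηt} dt`. -/
theorem integral_odd_mul_cexp_neg {h : ℝ → ℂ} (hodd : ∀ t, h (-t) = -h t) (η : ℝ) :
    ∫ t : ℝ, h t * cexp (-((η : ℂ) * t)) = -∫ t : ℝ, h t * cexp ((η : ℂ) * t) := by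
  have h1 := integral_neg_eq_self (fun t : ℝ ↦ h t * cexp (-((η : ℂ) * t))) volume
  simp only [hodd, Complex.ofReal_neg, mul_neg, neg_neg, neg_mul] at h1
  rw [integral_neg] at h1
  simpa [neg_mul, mul_neg] using h1.symm

/-- **The odd dipole separates a reflected pair**: for odd `h` and `g(t) = h(t)e^{−iγ₀t}`,
`ĝ(½ + η + iγ₀) − ĝ(1 − conj(½ + η + iγ₀)) = 2∫ h(t)e^{ηt} dt`. -/
theorem weilMellin_twist_sub_reflect {h : ℝ → ℂ} (hodd : ∀ t, h (-t) = -h t) (η γ₀ : ℝ) :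
    weilMellin (fun t ↦ h t * cexp (-(γ₀ * I) * t)) (1 / 2 + η + γ₀ * I) -
        weilMellin (fun t ↦ h t * cexp (-(γ₀ * I) * t)) (1 - conj (1 / 2 + η + γ₀ * I)) =
      2 * ∫ t : ℝ, h t * cexp ((η : ℂ) * t) := by
  have hrefl : 1 - conj ((1 : ℂ) / 2 + η + γ₀ * I) = 1 / 2 - η + γ₀ * I := by
    simp only [map_add, map_mul, map_div₀, map_one, map_ofNat, Complex.conj_ofReal, Complex.conj_I]
    ring
  rw [hrefl, weilMellin_mul_cexp, weilMellin_mul_cexp]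
  unfold weilMellin
  have e1 : ∀ t : ℝ, h t * cexp ((1 / 2 + (η : ℂ) + γ₀ * I + -(γ₀ * I) - 1 / 2) * t) =
      h t * cexp ((η : ℂ) * t) := by
    intro t; congr 2; ring
  have e2 : ∀ t : ℝ, h t * cexp ((1 / 2 - (η : ℂ) + γ₀ * I + -(γ₀ * I) - 1 / 2) * t) =
      h t * cexp (-((η : ℂ) * t)) := by
    intro t; congr 2; ring
  simp_rw [e1, e2, integral_odd_mul_cexp_neg hodd η]
  ring

/-- **Visibility inequality for the twisted odd dipole.**  Let `h` be an odd test function on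
`[−a, a]`, `ρ₀ = ½ + η + iγ₀` a zero of `ζ` (`|η| ≤ ½`, `γ₀ ≠ 0`), and `g(t) = h(t)e^{−iγ₀t}`.
If `sup_T Z_T(g) ≤ B` then `ε(a) ≤ (B − 4·m(ρ₀)·|∫ h(t)e^{ηt} dt|²) / ‖h‖₂²`.  (The pair
`{ρ₀, ρ₀*}` itself contributes `2m(ρ₀)|∫ h e^{ηt}|²` to `Z_T(g)`, so `ε(a) < 0` as soon as the pair
outweighs the sampling energy of `g` on all other zeros.) -/
theorem weilGroundEnergy_le_of_oddDipole {h : ℝ → ℂ} (hh : IsWeilTest h)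
    (hodd : ∀ t, h (-t) = -h t) {a : ℝ} (hhs : tsupport h ⊆ Icc (-a) a)
    (hpos : 0 < ∫ t, ‖h t‖ ^ 2) {η γ₀ : ℝ} (hζ : riemannZeta (1 / 2 + η + γ₀ * I) = 0)
    (hη : |η| ≤ 1 / 2) (hγ : γ₀ ≠ 0) {B : ℝ}
    (hB : ∀ T : ℝ, ∑ᶠ ρ ∈ weilZeroIndex T, (riemannZetaZeroOrder ρ : ℝ) *
      ‖weilMellin (fun t ↦ h t * cexp (-(γ₀ * I) * t)) ρ‖ ^ 2 ≤ B) :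
    weilGroundEnergy a ≤
      (B - 4 * ((riemannZetaZeroOrder (1 / 2 + η + γ₀ * I) : ℝ) *
        ‖∫ t : ℝ, h t * cexp ((η : ℂ) * t)‖ ^ 2)) / ∫ t, ‖h t‖ ^ 2 := by
  set g : ℝ → ℂ := fun t ↦ h t * cexp (-(γ₀ * I) * t) with hgdef
  have hg : IsWeilTest g := isWeilTest_mul_cexp hh _
  have hgs : tsupport g ⊆ Icc (-a) a := tsupport_mul_subset_left.trans hhs
  have hnorm : (∫ t, ‖g t‖ ^ 2) = ∫ t, ‖h t‖ ^ 2 := by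
    congr 1 with t
    rw [hgdef, norm_mul_cexp_neg_mul_I]
  have hposg : 0 < ∫ t, ‖g t‖ ^ 2 := by rwa [hnorm]
  have hre : (1 / 2 + (η : ℂ) + γ₀ * I).re = 1 / 2 + η := by simp
  have him : (1 / 2 + (η : ℂ) + γ₀ * I).im = γ₀ := by simp
  have h0 : 0 ≤ (1 / 2 + (η : ℂ) + γ₀ * I).re := by
    rw [hre]; linarith [neg_abs_le η]
  have h1 : (1 / 2 + (η : ℂ) + γ₀ * I).re ≤ 1 := by
    rw [hre]; linarith [le_abs_self η]
  have himne : (1 / 2 + (η : ℂ) + γ₀ * I).im ≠ 0 := by rwa [him]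
  have key := weilGroundEnergy_le_of_pair hg hgs hposg hζ h0 h1 himne hB
  rw [hnorm, hgdef, weilMellin_twist_sub_reflect hodd η γ₀] at key
  have h4 : ‖(2 : ℂ) * ∫ t : ℝ, h t * cexp ((η : ℂ) * t)‖ ^ 2 =
      4 * ‖∫ t : ℝ, h t * cexp ((η : ℂ) * t)‖ ^ 2 := by
    rw [norm_mul]
    norm_num
    ring
  rw [h4] at key
  convert key using 2
  ring

end Dipole

end Summit.RiemannHypothesis.RiemannHypothesis.Theorems
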